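import Literature.Computation.KummerOrbifold.Sectors
import HarnessLib

/-!
# Kummer orbifold model — invariant bases (Molien counts, Reynolds candidates, modular pivots) and
# class-level operators (`L_x` for untwisted `x`, degree operator, `Λ₀` by contraction)

Area `Literature/Computation/KummerOrbifold` (cell `hodge-kum4`, seat p1).  Per conjugacy-class
representative `r` and internal degree `d`, a basis of the centralizer-invariant reduced elements
(Reynolds averages of monomials, independence tested modulo `p = 2³¹ - 1`, candidate order
deterministically shuffled), stopped at the dimension predicted by the Molien-type count
`(1/|C(r)|) Σ_{c ∈ C(r)} det(1 + t c | W_P)^4`, `W_P = ℚ^{blocks}/⟨(|B|)_B⟩` (which for `m = 5`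
reproduces the Betti numbers `1,0,7,8,36,64,168,288,1046-624,…` of `Kum⁴`, Green–Kim–Laza–Robles
Cor. 32 / Göttsche).  Then: multiplication by an untwisted class (sector-wise wedge with its
restriction), the degree operator `h = deg - 2(m-1)`, and `Λ₀ := -½ ·` (sector-wise double
contraction by the inverse of the antisymmetric matrix of `ω₀|_{K_P}`, `ω₀ = X(e_0e_1 + e_2e_3)`),
which is the dual Lefschetz operator of `L_{ω₀}` on the invariant model (an `sl₂`-triple with `h`;
verified on all basis vectors by `Certificate5`).  Definitions only.

Sources: as `Sectors`; the Lefschetz/dual-Lefschetz formalism: Looijenga–Lunts 1997 §1; the `Kum_n`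
Betti numbers: Green–Kim–Laza–Robles 2022 Cor. 32.
-/

set_option autoImplicit false

namespace Literature.Computation.KummerOrbifold

namespace Poly
/-- truncated product of integer polynomials (coefficient lists) [folklore] -/
def mulTrunc (p q : Array Int) (dmax : Nat) : Array Int := Id.run do
  let mut out : Array Int := Array.replicate (dmax + 1) 0
  for i in [0:p.size] do
    if p[i]! != 0 then
      for j in [0:q.size] do
        if i + j ≤ dmax then out := out.set! (i + j) (out[i + j]! + p[i]! * q[j]!)
  return out
end Poly


namespace Model
variable (Mo : Model)

/-- expected dimension of the block (rep position `ri`, total degree `k`) for all `k`, as an array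
indexed by internal degree `d` (total degree = d + shift) — Molien average over the centralizer. [cite: GreenKimLazaRobles2022, Cor. 32 (Kum_n LLV decompositions; Betti numbers)] -/
def expectedDims (ri : Nat) : Array Nat := Id.run do
  let r := Mo.reps[ri]!
  let sec := Mo.sec[r]!
  let P := sec.P
  let l := P.size
  let cent := Mo.cent[ri]!
  let dmax := 4 * (l - 1)
  let mut tot : Array Int := Array.replicate (dmax + 1) 0
  for c in cent do
    let cp := Mo.G[c]!
    -- block permutation
    let img : Array Nat := P.map (fun B =>
      let B2 := (B.map (fun i => cp[i]!)).qsort (· < ·)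
      ((Array.range l).filter (fun bi => P[bi]! == B2))[0]!)
    -- its cycle lengths
    let cycs := Perm.orbits img
    let mut poly : Array Int := #[1]
    for cyc in cycs do
      let L := cyc.size
      let mut f : Array Int := Array.replicate (L + 1) 0
      f := f.set! 0 1
      f := f.set! L (-((-1 : Int) ^ L))
      poly := Poly.mulTrunc poly f (4 * l)
    -- divide by (1 + t): q with poly = (1+t) q
    let mut q : Array Int := Array.replicate (poly.size - 1) 0
    let mut rem := poly
    let mut i := poly.size - 1
    while i ≥ 1 do
      q := q.set! (i - 1) rem[i]!
      rem := rem.set! (i - 1) (rem[i - 1]! - rem[i]!)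
      rem := rem.set! i 0
      i := i - 1
    let mut p4 : Array Int := #[1]
    for _ in [0:4] do p4 := Poly.mulTrunc p4 q dmax
    for d in [0:dmax + 1] do
      tot := tot.set! d (tot[d]! + p4.getD d 0)
  return tot.map (fun x => (x / (cent.size : Int)).toNat)

/-- Betti numbers of the invariant model from the Molien counts [cite: GreenKimLazaRobles2022, Cor. 32 (Kum_n LLV decompositions; Betti numbers)] -/
def expectedBetti : Array Nat := Id.run do
  let top := 4 * (Mo.m - 1)
  let mut b : Array Nat := Array.replicate (top + 1) 0
  for ri in [0:Mo.reps.size] do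
    let sh := Mo.sec[Mo.reps[ri]!]!.shift
    let ed := Mo.expectedDims ri
    for d in [0:ed.size] do
      if sh + d ≤ top then b := b.set! (sh + d) (b[sh + d]! + ed[d]!)
  return b

/-- sub-masks of size `d` of a list of bits [folklore] -/
def combMasks : List Nat → Nat → List Nat
  | _, 0 => [0]
  | [], _ + 1 => []
  | i :: t, d + 1 => ((combMasks t d).map (fun m => m ||| (1 <<< i))) ++ combMasks t (d + 1)

/-- deterministic pseudo-random permutation of an array (LCG-driven Fisher–Yates), to reach full rank
with few Reynolds candidates (as g2's shuffled monomial order) [folklore] -/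
def shuffle (a : Array Nat) (seed : Nat := 12345) : Array Nat := Id.run do
  let mut a := a
  let mut st := seed
  let n := a.size
  if n < 2 then return a
  let mut i := n - 1
  while i > 0 do
    st := (st * 6364136223846793005 + 1442695040888963407) % 18446744073709551616
    let j := (st >>> 33) % (i + 1)
    let ai := a[i]!
    let aj := a[j]!
    a := (a.set! i aj).set! j ai
    i := i - 1
  return a

/-- (plumbing) [folklore] -/
def PRIME : Nat := 2147483647

/-- (plumbing) [folklore] -/
def powMod (b e : Nat) : Nat := Id.run do
  let mut r := 1
  let mut b := b % PRIME
  let mut e := e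
  while e > 0 do
    if e % 2 == 1 then r := r * b % PRIME
    b := b * b % PRIME
    e := e / 2
  return r

/-- (plumbing) [folklore] -/
def invMod (a : Nat) : Nat := powMod a (PRIME - 2)

/-- (plumbing) [folklore] -/
def ratModP (c : Rat) : Nat :=
  let nm : Nat := if c.num ≥ 0 then c.num.toNat % PRIME else (PRIME - ((-c.num).toNat % PRIME)) % PRIME
  nm * invMod (c.den % PRIME) % PRIME

/-- (plumbing) [folklore] -/
abbrev VecP := Std.HashMap Nat Nat

/-- (plumbing) [folklore] -/
def toVecP (x : Ext) : VecP :=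
  x.fold (fun (v : VecP) m c => let w := ratModP c; if w == 0 then v else v.insert m w)
    (Std.HashMap.emptyWithCapacity 64)

/-- modular echelon rows: (pivot mask, row with pivot coeff 1) [cite: FuTianVial2019, Thm. 1.5 (and Thm. 1.4; the orbifold product of §2 with discrete torsion)] -/
structure EchelonP where
  pivots : Array Nat
  rows : Array VecP
  deriving Inhabited

namespace EchelonP
/-- (plumbing) [folklore] -/
def empty : EchelonP := { pivots := #[], rows := #[] }

/-- (plumbing) [cite: FuTianVial2019, Thm. 1.5 (and Thm. 1.4; the orbifold product of §2 with discrete torsion)] -/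
def reduce (E : EchelonP) (v : VecP) : VecP :=
  (Array.range E.rows.size).foldl (fun (v : VecP) i =>
    let pm := E.pivots[i]!
    match v.get? pm with
    | none => v
    | some c =>
      if c == 0 then v else
      (E.rows[i]!).fold (fun (w : VecP) k cc =>
        let x := (w.getD k 0 + PRIME - (c * cc % PRIME)) % PRIME
        if x == 0 then w.erase k else w.insert k x) v) v

/-- returns (new echelon, independent?) [cite: FantechiGoettsche2003, §3 (Thm. 3.10, the ring structure; genus/obstruction rule)] -/
def push (E : EchelonP) (v : VecP) : EchelonP × Bool :=
  let v := E.reduce v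
  if v.isEmpty then (E, false) else
  let pm := v.fold (fun (b : Nat) k _ => min b k) (v.fold (fun (b : Nat) k _ => max b k) 0)
  let iv := invMod (v.getD pm 1)
  let v := v.fold (fun (w : VecP) k c => w.insert k (c * iv % PRIME)) (Std.HashMap.emptyWithCapacity 64)
  ({ pivots := E.pivots.push pm, rows := E.rows.push v }, true)
end EchelonP

/-- Reynolds-symmetrised candidates of internal degree `dint` in block `ri` (spanning the invariants),
as reduced `Ext`s; early exit after `want` independent ones were found is done by the caller. [cite: FuTianVial2019, Thm. 1.5 (and Thm. 1.4; the orbifold product of §2 with discrete torsion)] -/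
def blockBasis (ri : Nat) (dint : Nat) (want : Nat) : Array Ext × EchelonP := Id.run do
  let r := Mo.reps[ri]!
  let sec := Mo.sec[r]!
  let m := Mo.m
  let keptBits : List Nat := sec.kept.toList.flatMap (fun j => (List.range 4).map (fun a => 4 * j + a))
  let cent := Mo.cent[ri]!
  let monos := (shuffle (combMasks keptBits dint).toArray (12345 + 7 * dint + 131 * ri)).toList
  let mut E := EchelonP.empty
  let mut basis : Array Ext := #[]
  if want == 0 then return (basis, E)
  if r == Mo.idIdx then
    -- coset trick: S_{m-1} fixing the eliminated coordinate m-1 acts monomially on kept coords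
    let sub := cent.filter (fun c => (Mo.G[c]!)[m - 1]! == m - 1)
    let cos : Array Perm := #[Array.range m] ++ (Array.range (m - 1)).map (fun j =>
      (Array.range m).map (fun i => if i == j then m - 1 else if i == m - 1 then j else i))
    let cosIdx := cos.map (fun p => (Mo.idxOf.get? (Perm.code p)).getD 0)
    let mut seen : Std.HashMap Nat Unit := Std.HashMap.emptyWithCapacity 1024
    for mu in monos do
      if basis.size < want && !(seen.contains mu) then
        let x := Ext.single mu 1
        let mut orb : Ext := Ext.mk
        for c in sub do
          let (_, y) := Mo.push c r x
          orb := Ext.addInto orb y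
        if !orb.isEmpty then
          for (k, _) in orb.toList do seen := seen.insert k ()
          let mut tot : Ext := Ext.mk
          for c in cosIdx do
            let (_, y) := Mo.push c r orb
            tot := Ext.addInto tot (sec.reduce y)
          if !tot.isEmpty then
            let (E', indep) := E.push (toVecP tot)
            E := E'
            if indep then basis := basis.push tot
    return (basis, E)
  else
    let mut seen : Std.HashMap Nat Unit := Std.HashMap.emptyWithCapacity 1024
    for mu in monos do
      if basis.size < want && !(seen.contains mu) then
        let x := Ext.single mu 1
        let mut tot : Ext := Ext.mk
        for c in cent do
          let (_, y) := Mo.push c r x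
          let yr := sec.reduce y
          if y.size == 1 && Ext.beq yr y then
            for (k, _) in y.toList do seen := seen.insert k ()
          tot := Ext.addInto tot yr
        if !tot.isEmpty then
          let (E', indep) := E.push (toVecP tot)
          E := E'
          if indep then basis := basis.push tot
    return (basis, E)

/-- all block bases: for each rep position `ri` and internal degree `d`, the basis (reduced `Ext`s) [cite: FuTianVial2019, Thm. 1.5 (and Thm. 1.4; the orbifold product of §2 with discrete torsion)] -/
def allBases : Array (Array (Array Ext)) :=
  (Array.range Mo.reps.size).map (fun ri =>
    let ed := Mo.expectedDims ri
    (Array.range ed.size).map (fun d => (Mo.blockBasis ri d ed[d]!).1))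


end Model

/-! ## Class-level operators -/

namespace Model
variable (Mo : Model)


/-- product with an UNTWISTED class `x` (given as its identity-sector component): sector-wise wedge with
the restriction of `x`; input/output rep-dicts [cite: FantechiGoettsche2003, §3 (Thm. 3.10, the ring structure; genus/obstruction rule)] -/
def mulX (x : Ext) (Y : Cls) : Cls :=
  Y.fold (fun (out : Cls) r y =>
    let z := Ext.wedge (restrictTo x Mo.sec[r]!) y
    out.addComp r z) Cls.mk

/-- linear combination of rep-dicts [folklore] -/
def lin (Xs : List (Cls × Rat)) : Cls :=
  Xs.foldl (fun (out : Cls) (X, c) => Cls.add out X c) Cls.mk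

/-- `h = deg - mid` termwise (`mid = 2(m-1)`) [cite: LooijengaLunts1997, §1 p. 4 (the dual Lefschetz operator f_a)] -/
def hdeg (Y : Cls) : Cls :=
  let mid : Int := 2 * (Mo.m - 1)
  Y.fold (fun (out : Cls) r y =>
    let sh := Mo.sec[r]!.shift
    let z := y.fold (fun (z : Ext) k c =>
      let d : Int := (Ext.popcount k + sh : Nat)
      if d == mid then z else z.insert k (c * ((d - mid : Int) : Rat))) Ext.mk
    out.addComp r z) Cls.mk

/-- (plumbing) [folklore] -/
def isZeroCls (Y : Cls) : Bool :=
  Y.fold (fun ok r y => ok && (Mo.sec[r]!.reduce y).isEmpty) true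

/-- (plumbing) [folklore] -/
def equalCls (Y Z : Cls) : Bool := Mo.isZeroCls (lin [(Y, 1), (Z, -1)])

/-- exact inverse of a square rational matrix (Gauss–Jordan); garbage if singular [folklore] -/
def matInv (A : Array (Array Rat)) : Array (Array Rat) := Id.run do
  let n := A.size
  let mut Mx : Array (Array Rat) := (Array.range n).map (fun i =>
    A[i]! ++ (Array.range n).map (fun j => if i == j then (1 : Rat) else 0))
  for col in [0:n] do
    -- find pivot
    let mut piv := col
    let mut found := false
    for r in [col:n] do
      if !found && (Mx[r]!)[col]! != 0 then
        piv := r; found := true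
    if found then
      if piv != col then
        let rowp := Mx[piv]!
        let rowc := Mx[col]!
        Mx := (Mx.set! col rowp).set! piv rowc
      let ivp : Rat := 1 / (Mx[col]!)[col]!
      Mx := Mx.set! col ((Mx[col]!).map (· * ivp))
      let prow := Mx[col]!
      for r in [0:n] do
        if r != col then
          let f := (Mx[r]!)[col]!
          if f != 0 then
            Mx := Mx.set! r ((Array.range (2 * n)).map (fun j => (Mx[r]!)[j]! - f * prow[j]!))
  return Mx.map (fun row => row.extract n (2 * n))

/-- the reference class `ω₀ = X(e01 + e23)` (untwisted component) [cite: FuTianVial2019, Thm. 1.5 (and Thm. 1.4; the orbifold product of §2 with discrete torsion)] -/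
def om0 : Ext :=
  (List.range Mo.m).foldl (fun (tot : Ext) i =>
    Ext.addInto tot (Ext.relabel (Ext.addInto (e2 0 1) (e2 2 3)) (fun j => if j == 0 then i else j))) Ext.mk

/-- contraction data for `Λ₀` per rep position: kept bits and, for each kept bit index `i`, the functional
`φ_i = Σ_{j ≠ i} Gi_ij e_j^*` (`Gi` = inverse of the antisymmetric matrix of `ω₀|_{K_P}` in kept
generators); `none` for the point sector `l = 1` [cite: LooijengaLunts1997, §1 p. 4 (the dual Lefschetz operator f_a)] -/
def lamData : Array (Option (Array Nat × Array (Std.HashMap Nat Rat))) :=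
  Mo.reps.map (fun r =>
    let sec := Mo.sec[r]!
    if sec.P.size == 1 then none else
    let Om := sec.reduce (restrictTo Mo.om0 sec)
    let keptBits : Array Nat := sec.kept.foldl (fun acc j => acc ++ (Array.range 4).map (fun a => 4 * j + a)) #[]
    let N := keptBits.size
    let pos (b : Nat) : Nat := ((Array.range N).filter (fun i => keptBits[i]! == b))[0]!
    let G0 : Array (Array Rat) := Array.replicate N (Array.replicate N 0)
    let G := Om.fold (fun (G : Array (Array Rat)) msk c =>
      let bs := Ext.bits msk
      let i := pos bs[0]!
      let j := pos bs[1]!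
      let G := G.set! i ((G[i]!).set! j ((G[i]!)[j]! + c))
      G.set! j ((G[j]!).set! i ((G[j]!)[i]! - c))) G0
    let Gi := matInv G
    let phis : Array (Std.HashMap Nat Rat) := (Array.range N).map (fun i =>
      let row : Array Rat := Gi[i]!
      (List.range N).foldl (fun (h : Std.HashMap Nat Rat) j =>
        let c : Rat := row[j]!
        if j != i && c != 0 then h.insert keptBits[j]! c else h) (Std.HashMap.emptyWithCapacity 16))
    some (keptBits, phis))

/-- raw `Λ₀`: sector-wise `Σ_{i,j} Gi_ij ι_i ι_j` on reduced rep components (to be normalised) [cite: LooijengaLunts1997, §1 p. 4 (the dual Lefschetz operator f_a)] -/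
def lamRaw (LD : Array (Option (Array Nat × Array (Std.HashMap Nat Rat)))) (Y : Cls) : Cls :=
  Y.fold (fun (out : Cls) r y =>
    let ri := Mo.repPos r
    match LD[ri]! with
    | none => out
    | some (keptBits, phis) =>
      let yr := Mo.sec[r]!.reduce y
      let N := keptBits.size
      let tot := (List.range N).foldl (fun (tot : Ext) i =>
        let bi := keptBits[i]!
        let yi := Ext.contractBit yr bi
        if yi.isEmpty then tot else
          let phi := phis[i]!
          Ext.addInto tot (Ext.contract yi (fun b => phi.getD b 0))) Ext.mk
      out.addComp r tot) Cls.mk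


end Model

end Literature.Computation.KummerOrbifold
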